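import Mathlib

/-!
# Parabola lift, V: Lewko's base-205 square-difference-free sets (`|A| = N^{0.7334…}`)

Wall-breaker axis *parabola lifts over finite fields*, stub `stub_tangencySets` of the crux
`LevelOneGL2Designs` (stmt-MatrixMultiplication-14080).  Same digit construction as
`…ParabolaLiftSqDiffFree.lean` (Ruzsa 1984), with Ruzsa's modulus `65` replaced by Lewko's `205 = 5·41`
and the residue set

  `R = {0, 2, 8, 14, 77, 79, 85, 96, 103, 109, 111, 181} ⊆ ℤ/205`,  `|R| = 12`,

no two of whose elements differ by a square modulo `205` (re-found by exhaustive clique search,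
`comp/residues.py` of this seat; `12` is the maximum for modulus `205`).  The sets

  `A_k = { Σ_i dᵢ 205^i < 205^{2k} : d_{2j} ∈ R, d_{2j+1} arbitrary }`,  `|A_k| = 2460^k`, `2460 = 12·205`,

are square-difference-free, and `2460^15 > 42025^11` gives `|A_k| ≥ (42025^k)^{11/15}`, exponent
`11/15 = 0.7333… < 0.73341… = (1 + log 12 / log 205)/2`, the record of Lewko (2015) behind Theorem 1.2
of Hunter–Pohoata–Verstraëte–Zhang (2026).  Stated existentially; no definitions.

References: I. Z. Ruzsa, *Difference sets without squares* (1984), bib `Ruzsa1984DifferenceSetsWithoutSquares`;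
M. Lewko, *An improved lower bound related to the Furstenberg–Sárközy theorem*, Electron. J. Combin. 22
(2015) P1.32; HPVZ 2026 Lemma 2.2, bib `HunterPohoataVerstraeteZhang2026`.
-/

set_option linter.dupNamespace false

namespace Summit.MatrixMultiplication.MatrixMultiplication.Theorems.LevelOneGL2Designs.ParabolaLift

open Finset

set_option maxRecDepth 4000 in
/-- **Lewko's residue table.**  In `R = {0, 2, 8, 14, 77, 79, 85, 96, 103, 109, 111, 181}` no two distinct
residues differ by a square modulo `205`: `r' + z² ≡ r (mod 205)` forces `r = r'`.  Checked by `decide`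
(`12·12·205` cases). [cite: HunterPohoataVerstraeteZhang2026, Lemma 2.2 (Lewko's set)] -/
theorem lewko_residues_sqfree :
    ∀ r ∈ ({0, 2, 8, 14, 77, 79, 85, 96, 103, 109, 111, 181} : Finset ℕ),
      ∀ r' ∈ ({0, 2, 8, 14, 77, 79, 85, 96, 103, 109, 111, 181} : Finset ℕ),
        ∀ z : ℕ, z < 205 → (r' + z * z) % 205 = r → r = r' := by
  decide

/-- `205 = 5 · 41` is squarefree: `205 ∣ m²` implies `205 ∣ m`. [folklore] -/
theorem dvd_of_sq_dvd_205 {m : ℕ} (h : 205 ∣ m ^ 2) : 205 ∣ m := by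
  have h5 : 5 ∣ m := (Nat.Prime.dvd_of_dvd_pow (by norm_num) (dvd_trans (by norm_num) h))
  have h41 : 41 ∣ m := (Nat.Prime.dvd_of_dvd_pow (by norm_num) (dvd_trans (by norm_num) h))
  have : Nat.Coprime 5 41 := by norm_num
  simpa using this.mul_dvd_of_dvd_of_dvd h5 h41

/-- **Lewko-type square-difference-free sets** (base `42025 = 205²`, digit set `R + 205·[0,205)`): for
every `k` there is `A ⊆ [0, 42025^k)` with `|A| = 2460^k` and no two elements differing by a non-zero
perfect square (`a = b + m² → a = b`). [cite: HunterPohoataVerstraeteZhang2026, Lemma 2.2] -/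
theorem exists_sqDiffFree_digits205 (k : ℕ) :
    ∃ A : Finset ℕ, (∀ a ∈ A, a < 42025 ^ k) ∧ A.card = 2460 ^ k ∧
      ∀ a ∈ A, ∀ b ∈ A, ∀ m : ℕ, a = b + m ^ 2 → a = b := by
  induction k with
  | zero =>
    refine ⟨{0}, by simp, by simp, ?_⟩
    intro a ha b hb m _
    rw [mem_singleton] at ha hb
    rw [ha, hb]
  | succ k ih =>
    obtain ⟨A, hlt, hcard, hfree⟩ := ih
    set R : Finset ℕ := {0, 2, 8, 14, 77, 79, 85, 96, 103, 109, 111, 181} with hR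
    have hRlt : ∀ r ∈ R, r < 205 := by rw [hR]; decide
    have hRcard : R.card = 12 := by rw [hR]; rfl
    set g : ℕ × ℕ × ℕ → ℕ := fun t => t.1 + 205 * t.2.1 + 42025 * t.2.2 with hg
    set D : Finset (ℕ × ℕ × ℕ) := R ×ˢ (range 205 ×ˢ A) with hD
    have hmemD : ∀ t ∈ D, t.1 ∈ R ∧ t.2.1 < 205 ∧ t.2.2 ∈ A := by
      intro t ht
      simpa [hD, mem_product, mem_range] using ht
    refine ⟨D.image g, ?_, ?_, ?_⟩
    · -- range bound
      intro x hx
      obtain ⟨t, ht, rfl⟩ := mem_image.mp hx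
      obtain ⟨hr, hd, ha⟩ := hmemD t ht
      have := hlt _ ha
      have := hRlt _ hr
      simp only [hg]
      rw [pow_succ]
      omega
    · -- cardinality
      have hinj : Set.InjOn g ↑D := by
        intro t ht t' ht' h
        obtain ⟨hr, hd, -⟩ := hmemD t ht
        obtain ⟨hr', hd', -⟩ := hmemD t' ht'
        have := hRlt _ hr
        have := hRlt _ hr'
        simp only [hg] at h
        have h1 : t.1 = t'.1 := by omega
        have h2 : t.2.1 = t'.2.1 := by omega
        have h3 : t.2.2 = t'.2.2 := by omega
        exact Prod.ext h1 (Prod.ext h2 h3)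
      rw [card_image_of_injOn hinj, hD, card_product, card_product, card_range, hcard, hRcard, pow_succ]
      ring
    · -- no non-zero square differences
      intro x hx x' hx' m hm
      obtain ⟨t, ht, rfl⟩ := mem_image.mp hx
      obtain ⟨t', ht', rfl⟩ := mem_image.mp hx'
      obtain ⟨hr, hd, ha⟩ := hmemD t ht
      obtain ⟨hr', hd', ha'⟩ := hmemD t' ht'
      have hrlt := hRlt _ hr
      have hrlt' := hRlt _ hr'
      simp only [hg] at hm ⊢
      -- lowest digit: reduce modulo 205
      have hz : m % 205 < 205 := Nat.mod_lt _ (by norm_num)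
      have hmod : (t'.1 + m % 205 * (m % 205)) % 205 = t.1 := by
        have e1 : (t.1 + 205 * t.2.1 + 42025 * t.2.2) % 205 = t.1 := by omega
        have e2 : (t'.1 + 205 * t'.2.1 + 42025 * t'.2.2 + m ^ 2) % 205
            = (t'.1 + m % 205 * (m % 205)) % 205 := by
          rw [sq, Nat.add_mod, Nat.mul_mod]
          have : (t'.1 + 205 * t'.2.1 + 42025 * t'.2.2) % 205 = t'.1 % 205 := by omega
          rw [this, ← Nat.add_mod]
        rw [← e2, ← hm, e1]
      have hrr : t.1 = t'.1 := lewko_residues_sqfree _ hr _ hr' _ hz hmod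
      -- hence `205 ∣ m²`, so `205 ∣ m`
      set s := m ^ 2 with hs
      have h205 : 205 ∣ s := by omega
      obtain ⟨n, rfl⟩ := dvd_of_sq_dvd_205 (hs ▸ h205)
      have hsn : s = 42025 * n ^ 2 := by rw [hs]; ring
      have htail : t.2.2 = t'.2.2 + n ^ 2 := by omega
      have := hfree _ ha _ ha' n htail
      omega

end Summit.MatrixMultiplication.MatrixMultiplication.Theorems.LevelOneGL2Designs.ParabolaLift
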